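import Literature.Probability.Percolation.KozmaNitzanPreFKG
import Literature.Probability.LatticeModels.ProdBernoulliIndependence
import HarnessLib

/-!
# Crux `PercNearOneGluing.AdditiveGluing` (stmt-CriticalPhenomena-4576), line `tieline`: the multiplicative OBSERVER Lemma 4

Support file (`--supports stmt-CriticalPhenomena-4576`, lead c8, line `starglue/tieline` v16): the registered stubs
`stub_obsLemma4Mult_c8` and `stub_obsLemma4MultHarris_c8`.  No definitions, no named facts, no sorries.

For a weighted graph on `Fin n` (percolation measure `μ = prodBernoulli w`), a target `b`, a pair `{a₁, a₂}` and an
observer `o` write `D = {a₁ ↮ a₂}` and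
`gain_o = {o ↮ b} ∩ ({o ↔ a₁} ∪ {o ↔ a₂}) ∩ ({a₁ ↔ b} ∪ {a₂ ↔ b})` — the event that `o` is joined to `b` only after gluing
the pair.  Kozma–Nitzan's Lemma 4 / eq. (9) bounds the (additive) gain by the gain `π₁ = μ(a₁ ↮ b, a₂ ↔ b)` of the weaker
endpoint.  The theorems of this file are the MULTIPLICATIVE OBSERVER form: if `τ(a₁) = μ(a₁ ↔ b) ≤ μ(a₂ ↔ b) = τ(a₂)` then

* `μ(D) · μ(gain_o) ≤ μ(D ∩ ({o ↔ a₁} ∪ {o ↔ a₂})) · μ({a₁ ↮ b} ∩ {a₂ ↔ b})`  (`stub_obsLemma4Mult_c8`), and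
* `μ(gain_o) ≤ μ({o ↔ a₁} ∪ {o ↔ a₂}) · μ({a₁ ↮ b} ∩ {a₂ ↔ b})`  (`stub_obsLemma4MultHarris_c8`, by Harris).

Proof (the "BHK given `{a₁ ↮ a₂}`" pattern of Kozma–Nitzan's Theorem 1 / Lemma 4):
(1) `gain_o ⊆ (D ∩ {o↔a₁} ∩ {a₂↔b}) ∪ (D ∩ {o↔a₂} ∩ {a₁↔b})`;
(2) the van den Berg–Häggström–Kahn cross inequality (Thm. 1.4) twice:
`μ(D) μ(D ∩ {o↔a₁} ∩ {a₂↔b}) ≤ μ(D ∩ {o↔a₁}) μ(D ∩ {a₂↔b})` and symmetrically;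
(3) `μ(D ∩ {a₁↔b}) ≤ μ(D ∩ {a₂↔b})` from `τ(a₁) ≤ τ(a₂)` (the two events agree off `D`);
(4) `D ∩ {o↔a₁}` and `D ∩ {o↔a₂}` are disjoint; (5) `D ∩ {a₂↔b} = {a₁↮b} ∩ {a₂↔b}`.
The corollary divides by `μ(D)` after Harris' inequality `μ(D ∩ ({o↔a₁} ∪ {o↔a₂})) ≤ μ({o↔a₁} ∪ {o↔a₂}) μ(D)`
(increasing × decreasing).
[cite: KozmaNitzan2024, Lemma 4 (p. 9)] [cite: VandenbergHaggstromKahn2005, Thm. 1.4 (p. 7)]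
-/

namespace Summit.CriticalPhenomena.PercolationContinuityZ3.Theorems

open MeasureTheory Set Literature.Probability.LatticeModels Literature.Probability.Percolation
open Literature.Probability.Percolation.KNPreFKG

noncomputable section
open Classical

namespace ObsLemma4Mult

variable {V : Type*}

/-- Step (1): the observer's gain event lies in the union of the two crossed two-cluster events given
`{a₁ ↮ a₂}`: if `o ↮ b`, `o ↔ aᵢ` and `a₁ ↔ b ∨ a₂ ↔ b`, then `o ↔ aᵢ`, `a_{3-i} ↔ b` and `a₁ ↮ a₂`.
[cite: KozmaNitzan2024, Lemma 4 (p. 9)] -/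
theorem gain_subset (o b a₁ a₂ : V) :
    ((openConn o b)ᶜ ∩ (openConn o a₁ ∪ openConn o a₂) ∩ (openConn a₁ b ∪ openConn a₂ b) : Set (BondConfig V)) ⊆
      (openConn o a₁ ∩ openConn a₂ b ∩ (openConn a₁ a₂)ᶜ) ∪ (openConn o a₂ ∩ openConn a₁ b ∩ (openConn a₁ a₂)ᶜ) := by
  intro ω hω
  simp only [mem_inter_iff, mem_union, mem_compl_iff, openConn, mem_setOf_eq] at hω ⊢
  obtain ⟨⟨hob, h1 | h2⟩, hb1 | hb2⟩ := hω
  · exact absurd (h1.trans hb1) hob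
  · exact Or.inl ⟨⟨h1, hb2⟩, fun h => hob ((h1.trans h).trans hb2)⟩
  · exact Or.inr ⟨⟨h2, hb1⟩, fun h => hob ((h2.trans h.symm).trans hb1)⟩
  · exact absurd (h2.trans hb2) hob

/-- Step (1'): in particular the gain event forces `a₁ ↮ a₂`. [cite: KozmaNitzan2024, Lemma 4 (p. 9)] -/
theorem gain_subset_compl (o b a₁ a₂ : V) :
    ((openConn o b)ᶜ ∩ (openConn o a₁ ∪ openConn o a₂) ∩ (openConn a₁ b ∪ openConn a₂ b) : Set (BondConfig V)) ⊆
      (openConn a₁ a₂)ᶜ := by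
  refine (gain_subset o b a₁ a₂).trans ?_
  rintro ω (⟨_, h⟩ | ⟨_, h⟩) <;> exact h

variable [Fintype V]

/-- **Multiplicative observer Lemma 4** (general finite vertex type): if `μ(a₁ ↔ b) ≤ μ(a₂ ↔ b)` and `a₁ ≠ a₂`
then `μ(a₁↮a₂) · μ(gain_o) ≤ μ({a₁↮a₂} ∩ ({o↔a₁} ∪ {o↔a₂})) · μ({a₁↮b} ∩ {a₂↔b})`.  BHK Thm. 1.4 twice given
`{a₁ ↮ a₂}`, the `τ`-order on `{a₁ ↮ a₂}`, and disjointness of `{o↔a₁}`, `{o↔a₂}` on `{a₁ ↮ a₂}`.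
[cite: KozmaNitzan2024, Lemma 4 (p. 9)] [cite: VandenbergHaggstromKahn2005, Thm. 1.4 (p. 7)] -/
theorem obsLemma4Mult (w : Sym2 V → unitInterval) (o b a₁ a₂ : V) (h12 : a₁ ≠ a₂)
    (hτ : (prodBernoulli w).real (openConn a₁ b) ≤ (prodBernoulli w).real (openConn a₂ b)) :
    (prodBernoulli w).real ((openConn a₁ a₂)ᶜ : Set (BondConfig V)) *
        (prodBernoulli w).real ((openConn o b)ᶜ ∩ (openConn o a₁ ∪ openConn o a₂) ∩ (openConn a₁ b ∪ openConn a₂ b)) ≤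
      (prodBernoulli w).real ((openConn a₁ a₂)ᶜ ∩ (openConn o a₁ ∪ openConn o a₂)) *
        (prodBernoulli w).real ((openConn a₁ b)ᶜ ∩ openConn a₂ b) := by
  have hm : ∀ s : Set (BondConfig V), MeasurableSet s := fun _ => MeasurableSet.of_discrete
  -- step (1): the gain event is covered by the two crossed events
  have hgain : (prodBernoulli w).real
        (((openConn o b)ᶜ ∩ (openConn o a₁ ∪ openConn o a₂) ∩ (openConn a₁ b ∪ openConn a₂ b)) : Set (BondConfig V)) ≤
      (prodBernoulli w).real (openConn o a₁ ∩ openConn a₂ b ∩ (openConn a₁ a₂)ᶜ : Set (BondConfig V)) +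
        (prodBernoulli w).real (openConn o a₂ ∩ openConn a₁ b ∩ (openConn a₁ a₂)ᶜ : Set (BondConfig V)) :=
    (measureReal_mono (gain_subset o b a₁ a₂)).trans (measureReal_union_le _ _)
  set μ := prodBernoulli w with hμ
  set O₁ : Set (BondConfig V) := openConn o a₁ with hO₁
  set O₂ : Set (BondConfig V) := openConn o a₂ with hO₂
  set Ob : Set (BondConfig V) := openConn o b with hOb
  set B₁ : Set (BondConfig V) := openConn a₁ b with hB₁
  set B₂ : Set (BondConfig V) := openConn a₂ b with hB₂
  set D : Set (BondConfig V) := (openConn a₁ a₂)ᶜ with hD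
  have hsplit : ∀ A S : Set (BondConfig V), μ.real A = μ.real (A ∩ S) + μ.real (A ∩ Sᶜ) := by
    intro A S
    rw [← measureReal_inter_add_sdiff (s := A) (hm S), Set.sdiff_eq]
  -- step (3): `π₂ = μ(D ∩ B₁) ≤ μ(D ∩ B₂) = π₁` from `τ(a₁) ≤ τ(a₂)`
  have hpi1 : (B₁ᶜ ∩ B₂) = D ∩ B₂ := by
    ext ω
    simp only [mem_inter_iff, mem_compl_iff, hB₁, hB₂, hD, openConn, mem_setOf_eq]
    constructor
    · rintro ⟨hn1, hb2⟩
      exact ⟨fun h => hn1 (h.trans hb2), hb2⟩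
    · rintro ⟨hn, hb2⟩
      exact ⟨fun hb1 => hn (hb1.trans hb2.symm), hb2⟩
  have hpi2 : (B₁ ∩ B₂ᶜ) = D ∩ B₁ := by
    ext ω
    simp only [mem_inter_iff, mem_compl_iff, hB₁, hB₂, hD, openConn, mem_setOf_eq]
    constructor
    · rintro ⟨hb1, hn2⟩
      exact ⟨fun h => hn2 (h.symm.trans hb1), hb1⟩
    · rintro ⟨hn, hb1⟩
      exact ⟨hb1, fun hb2 => hn (hb1.trans hb2.symm)⟩
  have hθ1 : μ.real B₁ = μ.real (D ∩ B₁) + μ.real (B₁ ∩ B₂) := by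
    rw [hsplit B₁ B₂, hpi2]; ring
  have hθ2 : μ.real B₂ = μ.real (D ∩ B₂) + μ.real (B₁ ∩ B₂) := by
    rw [hsplit B₂ B₁, show B₂ ∩ B₁ = B₁ ∩ B₂ from inter_comm _ _, show B₂ ∩ B₁ᶜ = B₁ᶜ ∩ B₂ from inter_comm _ _,
      hpi1]
    ring
  have hπ : μ.real (D ∩ B₁) ≤ μ.real (D ∩ B₂) := by linarith
  -- step (4): `D ∩ O₁` and `D ∩ O₂` are disjoint
  have hOD : μ.real (D ∩ (O₁ ∪ O₂)) = μ.real (D ∩ O₁) + μ.real (D ∩ O₂) := by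
    have hd : Disjoint (D ∩ O₁) (D ∩ O₂) := by
      rw [Set.disjoint_left]
      rintro ω ⟨hn, h1⟩ ⟨_, h2⟩
      simp only [hD, hO₁, hO₂, mem_compl_iff, openConn, mem_setOf_eq] at hn h1 h2
      exact hn (h1.symm.trans h2)
    rw [inter_union_distrib_left, measureReal_union hd (hm _)]
  -- step (2): BHK Thm. 1.4 twice, given `D = {a₁ ↮ a₂}` (as in `KNPreFKG.preFKG_pair`)
  have hD1 : {ω : BondConfig V | ¬ (openGraph ω).Reachable a₁ a₂} = D := by
    ext ω
    simp only [mem_setOf_eq, hD, mem_compl_iff, openConn]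
  have hD3 : {ω : BondConfig V | ¬ (openGraph ω).Reachable a₂ a₁} = D := by
    ext ω
    simp only [mem_setOf_eq, hD, mem_compl_iff, openConn]
    exact not_congr ⟨SimpleGraph.Reachable.symm, SimpleGraph.Reachable.symm⟩
  -- (ii) `μ(D) μ(O₂ ∩ B₁ ∩ D) ≤ μ(D ∩ O₂) μ(D ∩ B₁)`
  have h_ii := bhk_two_upper_upper w a₂ a₁ (Ne.symm h12) (isUpperSet_connFamily a₂ o)
    (isUpperSet_connFamily a₁ b)
  rw [hD3, ← openConn_eq_setOf_connFamily, ← openConn_eq_setOf_connFamily, openConn_symm a₂ o] at h_ii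
  -- (iv) `μ(D) μ(O₁ ∩ B₂ ∩ D) ≤ μ(D ∩ O₁) μ(D ∩ B₂)`
  have h_iv := bhk_two_upper_upper w a₁ a₂ h12 (isUpperSet_connFamily a₁ o)
    (isUpperSet_connFamily a₂ b)
  rw [hD1, ← openConn_eq_setOf_connFamily, ← openConn_eq_setOf_connFamily, openConn_symm a₁ o] at h_iv
  have e2 : D ∩ (O₂ ∩ B₁) = O₂ ∩ B₁ ∩ D := inter_comm _ _
  have e4 : D ∩ (O₁ ∩ B₂) = O₁ ∩ B₂ ∩ D := inter_comm _ _
  simp only [← hμ, ← hO₁, ← hO₂, ← hB₁, ← hB₂] at h_ii h_iv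
  rw [e2] at h_ii
  rw [e4] at h_iv
  -- combine
  rw [hOD, hpi1]
  have hDnn : 0 ≤ μ.real D := measureReal_nonneg
  have hA2 : 0 ≤ μ.real (D ∩ O₂) := measureReal_nonneg
  calc μ.real D * μ.real (Obᶜ ∩ (O₁ ∪ O₂) ∩ (B₁ ∪ B₂))
      ≤ μ.real D * (μ.real (O₁ ∩ B₂ ∩ D) + μ.real (O₂ ∩ B₁ ∩ D)) := mul_le_mul_of_nonneg_left hgain hDnn
    _ = μ.real D * μ.real (O₁ ∩ B₂ ∩ D) + μ.real D * μ.real (O₂ ∩ B₁ ∩ D) := by ring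
    _ ≤ μ.real (D ∩ O₁) * μ.real (D ∩ B₂) + μ.real (D ∩ O₂) * μ.real (D ∩ B₁) := add_le_add h_iv h_ii
    _ ≤ μ.real (D ∩ O₁) * μ.real (D ∩ B₂) + μ.real (D ∩ O₂) * μ.real (D ∩ B₂) :=
        add_le_add le_rfl (mul_le_mul_of_nonneg_left hπ hA2)
    _ = (μ.real (D ∩ O₁) + μ.real (D ∩ O₂)) * μ.real (D ∩ B₂) := by ring

end ObsLemma4Mult

/-- **Registered stub `stub_obsLemma4Mult_c8`** (line `tieline`, crux `AdditiveGluing`): the multiplicative observer form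
of Kozma–Nitzan's Lemma 4.  With `D = {a₁ ↮ a₂}` and
`gain_o = {o ↮ b} ∩ ({o ↔ a₁} ∪ {o ↔ a₂}) ∩ ({a₁ ↔ b} ∪ {a₂ ↔ b})`, if `a₁ ≠ a₂` and `μ(a₁ ↔ b) ≤ μ(a₂ ↔ b)` then
`μ(D) · μ(gain_o) ≤ μ(D ∩ ({o ↔ a₁} ∪ {o ↔ a₂})) · μ({a₁ ↮ b} ∩ {a₂ ↔ b})`.  Proof: the BHK cross inequality
(Thm. 1.4) twice given `D`, the `τ`-order on `D`, disjointness of `{o ↔ a₁}`, `{o ↔ a₂}` on `D`.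
[cite: KozmaNitzan2024, Lemma 4 (p. 9)] [cite: VandenbergHaggstromKahn2005, Thm. 1.4 (p. 7)] -/
theorem stub_obsLemma4Mult_c8 : ∀ (n : ℕ) (w : Sym2 (Fin n) → unitInterval) (o b a₁ a₂ : Fin n), a₁ ≠ a₂ → (prodBernoulli w).real (openConn a₁ b) ≤ (prodBernoulli w).real (openConn a₂ b) → (prodBernoulli w).real ((openConn a₁ a₂)ᶜ : Set (BondConfig (Fin n))) * (prodBernoulli w).real ((openConn o b)ᶜ ∩ (openConn o a₁ ∪ openConn o a₂) ∩ (openConn a₁ b ∪ openConn a₂ b)) ≤ (prodBernoulli w).real ((openConn a₁ a₂)ᶜ ∩ (openConn o a₁ ∪ openConn o a₂)) * (prodBernoulli w).real ((openConn a₁ b)ᶜ ∩ openConn a₂ b) :=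
  fun _n w o b a₁ a₂ h12 hτ => ObsLemma4Mult.obsLemma4Mult w o b a₁ a₂ h12 hτ

/-- **Registered stub `stub_obsLemma4MultHarris_c8`** (line `tieline`, crux `AdditiveGluing`): the Harris corollary of
`stub_obsLemma4Mult_c8`.  If `a₁ ≠ a₂` and `μ(a₁ ↔ b) ≤ μ(a₂ ↔ b)` then
`μ({o ↮ b} ∩ ({o ↔ a₁} ∪ {o ↔ a₂}) ∩ ({a₁ ↔ b} ∪ {a₂ ↔ b})) ≤ μ({o ↔ a₁} ∪ {o ↔ a₂}) · μ({a₁ ↮ b} ∩ {a₂ ↔ b})`: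
Harris' inequality for the increasing event `{o ↔ a₁} ∪ {o ↔ a₂}` and the decreasing event `{a₁ ↮ a₂}` gives
`μ({a₁↮a₂} ∩ ({o↔a₁} ∪ {o↔a₂})) ≤ μ({o↔a₁} ∪ {o↔a₂}) μ(a₁↮a₂)`; divide by `μ(a₁ ↮ a₂)` (if it vanishes, so does the
gain, which forces `a₁ ↮ a₂`).
[cite: KozmaNitzan2024, Lemma 4 (p. 9)] [cite: VandenbergHaggstromKahn2005, Thm. 1.4 (p. 7)] -/
theorem stub_obsLemma4MultHarris_c8 : ∀ (n : ℕ) (w : Sym2 (Fin n) → unitInterval) (o b a₁ a₂ : Fin n), a₁ ≠ a₂ → (prodBernoulli w).real (openConn a₁ b) ≤ (prodBernoulli w).real (openConn a₂ b) → (prodBernoulli w).real ((openConn o b)ᶜ ∩ (openConn o a₁ ∪ openConn o a₂) ∩ (openConn a₁ b ∪ openConn a₂ b)) ≤ (prodBernoulli w).real (openConn o a₁ ∪ openConn o a₂) * (prodBernoulli w).real ((openConn a₁ b)ᶜ ∩ openConn a₂ b) := by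
  intro n w o b a₁ a₂ h12 hτ
  have hm : ∀ s : Set (BondConfig (Fin n)), MeasurableSet s := fun _ => MeasurableSet.of_discrete
  have key := stub_obsLemma4Mult_c8 n w o b a₁ a₂ h12 hτ
  -- Harris, increasing × decreasing
  have hupO : IsUpperSet (openConn o a₁ ∪ openConn o a₂ : Set (BondConfig (Fin n))) :=
    (isUpperSet_openConn o a₁).union (isUpperSet_openConn o a₂)
  have hloD : IsLowerSet ((openConn a₁ a₂)ᶜ : Set (BondConfig (Fin n))) := (isUpperSet_openConn a₁ a₂).compl
  have hH : (prodBernoulli w).real ((openConn a₁ a₂)ᶜ ∩ (openConn o a₁ ∪ openConn o a₂) : Set (BondConfig (Fin n))) ≤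
      (prodBernoulli w).real (openConn o a₁ ∪ openConn o a₂ : Set (BondConfig (Fin n))) *
        (prodBernoulli w).real ((openConn a₁ a₂)ᶜ : Set (BondConfig (Fin n))) := by
    rw [inter_comm]
    exact prodBernoulli_harris_upper_lower w hupO hloD (hm _) (hm _)
  by_cases hD0 : (prodBernoulli w).real ((openConn a₁ a₂)ᶜ : Set (BondConfig (Fin n))) = 0
  · -- the gain event forces `a₁ ↮ a₂`, so it is null as well
    rw [measureReal_mono_null (ObsLemma4Mult.gain_subset_compl o b a₁ a₂) hD0]
    exact mul_nonneg measureReal_nonneg measureReal_nonneg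
  · have hDpos : 0 < (prodBernoulli w).real ((openConn a₁ a₂)ᶜ : Set (BondConfig (Fin n))) :=
      lt_of_le_of_ne measureReal_nonneg (Ne.symm hD0)
    refine le_of_mul_le_mul_left (key.trans ?_) hDpos
    calc (prodBernoulli w).real ((openConn a₁ a₂)ᶜ ∩ (openConn o a₁ ∪ openConn o a₂) : Set (BondConfig (Fin n))) *
          (prodBernoulli w).real ((openConn a₁ b)ᶜ ∩ openConn a₂ b : Set (BondConfig (Fin n)))
        ≤ (prodBernoulli w).real (openConn o a₁ ∪ openConn o a₂ : Set (BondConfig (Fin n))) *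
            (prodBernoulli w).real ((openConn a₁ a₂)ᶜ : Set (BondConfig (Fin n))) *
            (prodBernoulli w).real ((openConn a₁ b)ᶜ ∩ openConn a₂ b : Set (BondConfig (Fin n))) :=
          mul_le_mul_of_nonneg_right hH measureReal_nonneg
      _ = (prodBernoulli w).real ((openConn a₁ a₂)ᶜ : Set (BondConfig (Fin n))) *
            ((prodBernoulli w).real (openConn o a₁ ∪ openConn o a₂ : Set (BondConfig (Fin n))) *
              (prodBernoulli w).real ((openConn a₁ b)ᶜ ∩ openConn a₂ b : Set (BondConfig (Fin n)))) := by ring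

end

end Summit.CriticalPhenomena.PercolationContinuityZ3.Theorems
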